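import Summits.BirchSwinnertonDyer.BirchSwinnertonDyer.Theorems.KimAtThreeKolyvaginDeepLowerKatoStratum
import Summits.BirchSwinnertonDyer.Rank1Residual.Additive.N11KimAtThreeDeepCertPUB
import Summits.BirchSwinnertonDyer.Rank1Residual.Additive.X4RankZeroKatoBoundTamagawaExact
import HarnessLib

/-!
# LOWER@3 per pair from ONE Kurihara certificate of ANY depth at `t = 0`, GRANTED cell n1011's (a′) inputs (not the
# cell's conjecture name) — and `BSD(E,3)` on the TAMAGAWA rows with Kato's Tamagawa-exact reading
# (route W2 `KimAtThreeKolyvagin` per-pair lane; cell `bsd-addord`, seat kim3 gen 8; programme row B3 = N11 «LOWER@3 via one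
# certificate per pair»)

HONEST FRAMING. Theorems only (no definition, no named fact, no `sorry`); nothing asserted, nothing booked, no mark moved.
PER-PAIR record shape, NOT a class theorem. CONDITIONAL on: [S24] Thm. 4.4 (1)(2) typed facts `hS24`/`hS24₂` (PUB), GZK,
the Poitou–Tate families, ONE repaired dictionary port `KatoKuriharaPortThreeAtWith₂ W 0 v₃ η D` (FLAG `K22-Thm3.13-PORT@3`,
NOT in print at `3`); the `BSDp` ending also on Kato's Tamagawa-exact reading (BC5 fact) and modularity, by name.

WHAT.  The cell's per-pair LOWER lane (`N11.missingLowerBoundAt_three_of_kimAtThreeDeepCertPUB_of_cert`, gen 3) was keyed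
on the `@[conjecture]` NAME `N11.KimAtThreeDeepCertPUB` (Cor C-t); n1011's repaired-port records reach only UNIT
certificates (`j = 1`).  On the rows where the `3`-part of BSD is NOT decided by a unit — `3 ∣ ∏_ℓ c_ℓ` (no unit exists
there at `t = 0`: the T0-TAM law, `KimAtThreeKolyvaginDeepLowerKatoStratumShallow`) — the lower half needs a certificate of
depth `v₃(∏ c_ℓ) + 1`, e.g. `δ̃_n ≡ 3·unit (mod 9)` at an `𝒩₂` pair when `v₃(∏ c_ℓ) = 1` («second digit attained»,
46/62 rows in gen 7's T0-TAM interim).  This file re-keys the lane on n1011's ports: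
* `missingLowerBoundAt_three_of_ports_of_cert` — row {tower onto, additive `3`, `3 ∤ c₃`, `E(ℚ₃)[3] = 0`, datum `D` with
  `3 ∤ c_D` + period transfer (level prime to the certificate's primes), `L(E,1) ≠ 0`}, ports, ONE certificate
  `δ̃^{(j)}_n(ψ) ≠ 0` at a cyclic `n ∈ 𝒩_{k+1}(E,3)` with `j ≤ k + 1` and `j − 1 ≤ v₃(∏ c_ℓ)` ⟹ `MissingLowerBoundAt W 3`
  (`ord₃ #Ш_an ≤ ord₃ #Ш`); the unit case `j = 1` needs no Tamagawa clause;
* `bsdp_three_of_ports_of_cert_of_kato2004TamagawaExact` — the same on POTENTIALLY GOOD rows + Kato Thm. 14.5 (3)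
  Tamagawa-exact (`X4RankZero.bsdp_of_missingLowerBoundAt_of_katoTam`) ⟹ `BSDp W 3`.
So at `t = 0` the per-pair road to `BSD(E,3)` on a tower ∧ pot-good ∧ `3 ∤ c₃` row with `3 ∣ #Ш_an` is: ONE Kurihara
number `δ̃_n ≢ 0 (mod 3^{v₃(∏c)+1})` at a cyclic level of depth `≥ v₃(∏ c) + 1` — modulo the ports and PUB facts.
References: [Kim2025RefinedTNC] Thm 1.1; [Kim2022StructureSelmer] Thm. 1.9 (6); [Sakamoto2024] Thm. 4.4; [Kato2004Asterisque]
Thm. 14.5 (3), Prop. 14.16 (2); [Miller2011LMS] Def. 1.1; memo `run/shared/lean/pub/bsd-addord/kim3/KIM3-PROOF.md` §16.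
-/

set_option autoImplicit false
-- the Theorems namespace of a single-conjunct summit repeats the summit name by design (D-0017)
set_option linter.dupNamespace false

noncomputable section

open scoped Classical NumberField ContRepresentation
open Function Field NumberField IsDedekindDomain IsDedekindDomain.HeightOneSpectrum WeierstrassCurve
  CongruenceSubgroup
  Literature.NumberTheory.EllipticCurves Literature.NumberTheory.EllipticCurves.ModularForms
  Literature.NumberTheory.EllipticCurves.Rank1Residual Literature.NumberTheory.EllipticCurves.Rank1Residual.Typed
  Literature.NumberTheory.GaloisRepresentations
  Literature.NumberTheory.GaloisRepresentations.DiscreteGaloisModule Literature.NumberTheory.GaloisCohomology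
  Rat.HeightOneSpectrum
  Summit.BirchSwinnertonDyer.Rank1Residual.GaloisImage
  Summit.BirchSwinnertonDyer.Rank1Residual.X4
  Summit.BirchSwinnertonDyer.Rank1Residual.Additive
  Summit.BirchSwinnertonDyer.Rank1Residual.Additive.N11
  Summit.BirchSwinnertonDyer.BirchSwinnertonDyer.Theorems.KimAtThreeKolyvaginDeepLowerKatoStratum

namespace Summit.BirchSwinnertonDyer.BirchSwinnertonDyer.Theorems.KimAtThreeKolyvaginLowerHalfOfDeepCertificate

/-- **LOWER@3 from ONE certificate of any depth, GRANTED n1011's (a′) inputs at `t = 0`.**  Row: `W/ℚ` globally minimal,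
ADDITIVE at `3` with `3 ∤ c₃`, the `3`-adic tower onto, `E(ℚ₃)[3] = 0`, `L(E,1) ≠ 0`, a datum `D` with `3 ∤ c_D` and the
period transfer; inputs `hS24`/`hS24₂`, GZK, the Poitou–Tate families, ONE port `KatoKuriharaPortThreeAtWith₂ W 0 v₃ η D`;
certificate: a cyclic `n ∈ 𝒩_{k+1}(E,3)` whose primes do not divide the level `N`, surjective `ψ ↠ ℤ/3^j` with `j ≤ k + 1`,
`δ̃^{(j)}_n(ψ) ≠ 0`, and the Tamagawa clause `j − 1 ≤ v₃(∏_ℓ c_ℓ)`.  THEN `MissingLowerBoundAt W 3` (`ord₃ #Ш_an ≤ ord₃ #Ш`):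
step (2) of `KimAtThreeKolyvaginDeepLowerKatoStratum` gives `ord₃(L(E,1)/Ω(W)) ≤ ord₃ #Ш(3) + (j − 1)` and
`#Ш_an = (L/Ω)·#E(ℚ)²_tors/∏ c_ℓ` with `3 ∤ #E(ℚ)_tors` (irreducibility).  The twin of the cell's
`N11.missingLowerBoundAt_three_of_kimAtThreeDeepCertPUB_of_cert` with the `@[conjecture]` name replaced by the ports (same
BSD-currency bookkeeping, credit kim3 gen 3). [cite: Kim2025RefinedTNC, Thm. 1.1 ("BSD")] [cite: Sakamoto2024, Thm. 4.4 (p. 926)]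
[cite: Miller2011LMS, Def. 1.1] -/
theorem missingLowerBoundAt_three_of_ports_of_cert
    (hS24 : Sakamoto2024.kolyvaginSystems_freeRankOne_zmod_three_pow)
    (hS24₂ : Sakamoto2024.kolyvaginSystems_idealOfBasis_eq_fittingIdeal_zmod_three_pow)
    (hGZK : rank_eq_analyticRank_of_analyticRank_le_one)
    (W : WeierstrassCurve ℚ) [W.IsElliptic] [W.IsGloballyMinimal]
    (hadd : haveI : Fact (Nat.Prime 3) := ⟨Nat.prime_three⟩; Addv W 3)
    (hc3 : ¬ 3 ∣ (W.baseChange ℚ_[3]).localTamagawaNumber ℤ_[3])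
    (htower : ∀ m : ℕ, W.HasSurjectiveModNGaloisRep (3 ^ m : ℕ))
    (ht0 : Nat.card {Q : (W.baseChange ℚ_[3]).toAffine.Point // (3 : ℕ) • Q = 0} = 1)
    (hL : W.entireLFunction 1 ≠ 0)
    {N : ℕ} [NeZero N] (D : ModularParametrizationData W N) (hcD : ¬ (3 : ℤ) ∣ D.maninConstant)
    (hper : ∃ u : ℚ, ‖(u : ℚ_[3])‖ = 1 ∧ W.realPeriodRat = u * plusPeriod D.f)
    (inv : LocalInvariants ℚ 3) (hperf : inv.IsPerfect) (hsum : inv.SumLocalTermEqZero)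
    (hcompl : inv.SelmerComplement)
    (inv' : ∀ k' : ℕ, LocalInvariants ℚ (3 ^ (k' + 1))) (hperf' : ∀ k', (inv' k').IsPerfect)
    (hsum' : ∀ k', (inv' k').SumLocalTermEqZero) (hcompl' : ∀ k', (inv' k').SelmerComplement)
    (hinj' : ∀ k', ∀ v : HeightOneSpectrum (𝓞 ℚ), Injective (inv' k' (Sum.inr v)))
    (v₃ : HeightOneSpectrum (𝓞 ℚ)) (hv₃ : ((3 : ℕ) : 𝓞 ℚ) ∈ v₃.asIdeal)
    (η : (q : HeightOneSpectrum (𝓞 ℚ)) → (ZMod (Ideal.absNorm q.asIdeal))ˣ)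
    (hη : ∀ q : HeightOneSpectrum (𝓞 ℚ), Subgroup.zpowers (η q) = ⊤)
    (hPort : KatoKuriharaPortThreeAtWith₂ W 0 v₃ η D)
    {k : ℕ} {n : ℕ} [NeZero n] (hn : Kato.IsKolyvaginProduct W 3 (k + 1) n)
    (hcyc : ∀ (ℓ : ℕ) [Fact ℓ.Prime], ℓ ∣ n →
      Nat.card {P : ((integralModelInt W).map (Int.castRingHom (ZMod ℓ))).toAffine.Point //
        3 • P = 0} ≤ 3)
    (hnN : ∀ ℓ ∈ n.primeFactors, ¬ ℓ ∣ N) {j : ℕ} (hjk : j ≤ k + 1)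
    (ψ : (ℓ : ℕ) → (ZMod ℓ)ˣ →* Multiplicative (ZMod (3 ^ j)))
    (hψ : ∀ ℓ ∈ n.primeFactors, Function.Surjective (ψ ℓ))
    (hcert : kuriharaNumber D.f (3 ^ j) n ψ ≠ 0) (hjt : j - 1 ≤ padicValNat 3 W.tamagawaProduct) :
    MissingLowerBoundAt W 3 := by
  haveI : Fact (Nat.Prime 3) := ⟨Nat.prime_three⟩
  have hr0 : W.analyticRank = 0 := analyticRank_eq_zero_of_entireLFunction_one_ne_zero W hL
  obtain ⟨hmw, hfin⟩ := hGZK W (by rw [hr0]; exact zero_le_one)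
  haveI : Finite W.sha := hfin
  obtain ⟨q₀, hq₀, hle⟩ := exists_LOmega_padicValRat_le_of_towerSurj_with_depth_of_anyCertificate hS24 hS24₂ hGZK
    W hadd hc3 htower ht0 hL D hcD hper inv hperf hsum hcompl inv' hperf' hsum' hcompl' hinj' v₃ hv₃ η hη hPort k n hn
    hcyc hnN hjk ψ hψ hcert
  have hq₀0 : q₀ ≠ 0 := rankZero_witness_ne_zero W hL hq₀
  have hirr : W.HasIrreducibleModPGaloisRep 3 :=
    hasIrreducibleModPGaloisRep_of_hasSurjectiveModNGaloisRep W 3 (by simpa using htower 1)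
  refine ⟨q₀ * (W.torsionOrder : ℚ) ^ 2 / (W.tamagawaProduct : ℚ),
    shaAn_eq_of_rankZero_witness W hmw hL hq₀, ?_⟩
  have hsha : padicValNat 3 (Nat.card (AddCommGroup.primaryComponent W.sha 3)) =
      padicValNat 3 W.shaOrder := by
    unfold WeierstrassCurve.shaOrder
    exact padicValNat_card_addPrimaryComponent 3
  have hjt' : ((j - 1 : ℕ) : ℤ) ≤ (padicValNat 3 W.tamagawaProduct : ℤ) := by exact_mod_cast hjt
  rw [Summit.BirchSwinnertonDyer.Rank1Residual.Supersingular.padicValRat_shaAn_witness W 3 hirr hq₀0, ← hsha]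
  linarith

/-- **`BSD(E,3)` per pair from ONE certificate of depth `v₃(∏ c_ℓ) + 1` on the TAMAGAWA rows, GRANTED n1011's (a′) inputs +
Kato's Tamagawa-exact reading.**  Row as above and POTENTIALLY GOOD at `3` (`0 ≤ v₃(j)`); the lower half from
`missingLowerBoundAt_three_of_ports_of_cert`, the upper half from Kato Thm. 14.5 (3) Tamagawa-exact
(`X4RankZero.bsdp_of_missingLowerBoundAt_of_katoTam`, facts `hKato`, `hGZK`, `hmod` by name).  Clientele: the `t = 0` tower
rows with `3 ∣ #Ш_an` and `3 ∣ ∏ c_ℓ`, where no UNIT Kurihara number exists and the visible-element road stops at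
`ord₃ #Ш_an ≤ 2`. [cite: Kato2004Asterisque, Thm. 14.5 (3) (p. 236), Prop. 14.16 (2) (p. 244)] [cite: Kim2025RefinedTNC, Thm. 1.1]
[cite: Miller2011LMS, §1 and Def. 1.1] -/
theorem bsdp_three_of_ports_of_cert_of_kato2004TamagawaExact
    (hKato : Kato2004.rankZero_padicValNat_sha_add_padicValNat_tamagawa_le_of_additive_potGood_of_imageContainsSL2)
    (hmod : hasEntireLFunction_rat)
    (hS24 : Sakamoto2024.kolyvaginSystems_freeRankOne_zmod_three_pow)
    (hS24₂ : Sakamoto2024.kolyvaginSystems_idealOfBasis_eq_fittingIdeal_zmod_three_pow)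
    (hGZK : rank_eq_analyticRank_of_analyticRank_le_one)
    (W : WeierstrassCurve ℚ) [W.IsElliptic] [W.IsGloballyMinimal]
    (hadd : haveI : Fact (Nat.Prime 3) := ⟨Nat.prime_three⟩; Addv W 3) (hpot : 0 ≤ padicValRat 3 W.j)
    (hc3 : ¬ 3 ∣ (W.baseChange ℚ_[3]).localTamagawaNumber ℤ_[3])
    (htower : ∀ m : ℕ, W.HasSurjectiveModNGaloisRep (3 ^ m : ℕ))
    (ht0 : Nat.card {Q : (W.baseChange ℚ_[3]).toAffine.Point // (3 : ℕ) • Q = 0} = 1)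
    (hL : W.entireLFunction 1 ≠ 0)
    {N : ℕ} [NeZero N] (D : ModularParametrizationData W N) (hcD : ¬ (3 : ℤ) ∣ D.maninConstant)
    (hper : ∃ u : ℚ, ‖(u : ℚ_[3])‖ = 1 ∧ W.realPeriodRat = u * plusPeriod D.f)
    (inv : LocalInvariants ℚ 3) (hperf : inv.IsPerfect) (hsum : inv.SumLocalTermEqZero)
    (hcompl : inv.SelmerComplement)
    (inv' : ∀ k' : ℕ, LocalInvariants ℚ (3 ^ (k' + 1))) (hperf' : ∀ k', (inv' k').IsPerfect)
    (hsum' : ∀ k', (inv' k').SumLocalTermEqZero) (hcompl' : ∀ k', (inv' k').SelmerComplement)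
    (hinj' : ∀ k', ∀ v : HeightOneSpectrum (𝓞 ℚ), Injective (inv' k' (Sum.inr v)))
    (v₃ : HeightOneSpectrum (𝓞 ℚ)) (hv₃ : ((3 : ℕ) : 𝓞 ℚ) ∈ v₃.asIdeal)
    (η : (q : HeightOneSpectrum (𝓞 ℚ)) → (ZMod (Ideal.absNorm q.asIdeal))ˣ)
    (hη : ∀ q : HeightOneSpectrum (𝓞 ℚ), Subgroup.zpowers (η q) = ⊤)
    (hPort : KatoKuriharaPortThreeAtWith₂ W 0 v₃ η D)
    {k : ℕ} {n : ℕ} [NeZero n] (hn : Kato.IsKolyvaginProduct W 3 (k + 1) n)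
    (hcyc : ∀ (ℓ : ℕ) [Fact ℓ.Prime], ℓ ∣ n →
      Nat.card {P : ((integralModelInt W).map (Int.castRingHom (ZMod ℓ))).toAffine.Point //
        3 • P = 0} ≤ 3)
    (hnN : ∀ ℓ ∈ n.primeFactors, ¬ ℓ ∣ N) {j : ℕ} (hjk : j ≤ k + 1)
    (ψ : (ℓ : ℕ) → (ZMod ℓ)ˣ →* Multiplicative (ZMod (3 ^ j)))
    (hψ : ∀ ℓ ∈ n.primeFactors, Function.Surjective (ψ ℓ))
    (hcert : kuriharaNumber D.f (3 ^ j) n ψ ≠ 0) (hjt : j - 1 ≤ padicValNat 3 W.tamagawaProduct) :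
    BSDp W 3 := by
  haveI : Fact (Nat.Prime 3) := ⟨Nat.prime_three⟩
  have hr0 : W.analyticRank = 0 := analyticRank_eq_zero_of_entireLFunction_one_ne_zero W hL
  have hX : ClassX4 W 3 := ⟨by norm_num, ⟨hadd.1, hadd.2⟩,
    hasIrreducibleModPGaloisRep_of_hasSurjectiveModNGaloisRep W 3 (by simpa using htower 1)⟩
  exact X4RankZero.bsdp_of_missingLowerBoundAt_of_katoTam W 3 hKato hGZK hmod hr0 hX hpot htower
    (missingLowerBoundAt_three_of_ports_of_cert hS24 hS24₂ hGZK W hadd hc3 htower ht0 hL D hcD hper inv hperf hsum hcompl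
      inv' hperf' hsum' hcompl' hinj' v₃ hv₃ η hη hPort hn hcyc hnN hjk ψ hψ hcert hjt)

end Summit.BirchSwinnertonDyer.BirchSwinnertonDyer.Theorems.KimAtThreeKolyvaginLowerHalfOfDeepCertificate

end
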